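import Summits.CriticalPhenomena.PercolationContinuityZ3.Theorems.Transplant.PlanarCellsFaces
import Literature.Probability.Percolation.KozmaNitzanSteps
import HarnessLib

/-!
# Kozma–Nitzan's planar cells in `ℤ²`, part 4 (file `PlanarCellsPSep2`; re-proposal of the gate-stalled `PlanarCellsPSep`): NO-EDGE separation (`KozmaNitzan.Sep` at `d = 2`) of the far region `E^far_{v,x}` from the
# cells and stub zones of the other macro-vertices and from the other between-boxes of `v`; the reversed between-box; levels along a
# macro-direction (the planar input of the face-prefix geometry (I3) of the scheme over cells; BLUEPRINT-I-PHI §1 row "cells")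

builds on p205010 (kernel theorem, internal audit signed; external expert review pending) — nothing in this file uses p205010.
Lane `prim-bschramm`, seat `prim-bschramm-p3`; helper file (`--supports stmt-CriticalPhenomena-4575 --as helper`).  Continues
`PlanarCellsDefs/Sep/Faces`.

* `lev δ v t = σ (t_a - cen v_a)` — the level of `t` along the macro-direction `δ = (a, σ)` from `v`; `lev_adj` (a lattice step changes it
  by at most one), levels of `Q_v`, `E^far`, `H`, `H^j`, `F^j`;
* `Btw_rev'` — `Btw (v + δ) (rev δ) = Btw v δ` (planar twin of KN's `Btw_rev`);
* `sep_of_two_ne` — two planar points differing in both coordinates are neither equal nor adjacent;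
* **`Cell_sep_Efar`**, **`Zone_sep_Efar`** (`u ≠ v`, `u ≠ v + δ`), **`Btw_sep_Efar`** (`δ' ≠ δ`): KN's `cell_sep_Efar`, `zone_sep_Efar`,
  `Btw_sep_Efar` at `d = 2` — no common vertex and no edge of `ℤ²`.

[cite: KozmaNitzan2024, §4 pp. 26, 31 — the ℤ^d model]
-/

noncomputable section

namespace Summit.CriticalPhenomena.PercolationContinuityZ3.Theorems

namespace Transplant

open Literature.Probability.Percolation Literature.Probability.LatticeModels SimpleGraph GadgetSystem Contour
open Literature.Probability.Percolation.KozmaNitzan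
open Literature.Probability.Percolation.KozmaNitzan.Cells (oth oth_ne sgOf sgOf_sign stepVec_apply_fst stepVec_apply_oth eq_oth_of_ne oth_oth
  eq_of_coords)

namespace PCells

variable (C : PCells)

/-! ## Levels -/

/-- The level of `t` along `δ` from `v`: `σ (t_a - cen v_a)`. [cite: KozmaNitzan2024, §4 p. 30] -/
def lev (δ : MDir) (v : Site 2) (t : Site 2) : ℤ := sgOf δ * (t δ.1 - C.cen v δ.1)

/-- A lattice step changes the level by at most one. [folklore] -/
theorem lev_adj (δ : MDir) (v : Site 2) {t t' : Site 2} (h : (zdGraph 2).Adj t t') :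
    C.lev δ v t' = C.lev δ v t ∨ C.lev δ v t' = C.lev δ v t + 1 ∨ C.lev δ v t' = C.lev δ v t - 1 := by
  unfold lev
  rcases level_adj (a := δ.1) (sgOf_sign δ) (C.cen v) h with ⟨h1, -⟩ | ⟨h1, -⟩
  · exact Or.inl h1
  · rcases h1 with h1 | h1
    · exact Or.inr (Or.inl h1)
    · exact Or.inr (Or.inr h1)

/-- Points of `Q_v` have level at most `5r`. [folklore] -/
theorem lev_le_of_mem_Q {δ : MDir} {v t : Site 2} (ht : t ∈ C.Q v) : C.lev δ v t ≤ 5 * C.r := by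
  rw [Q, C.mem_sq_iff] at ht
  have h := ht δ.1; push_cast at h
  unfold lev; rcases sgOf_sign δ with hs | hs <;> rw [hs] <;> omega

/-- Points of `E^far_{v,δ}` have level at least `5r + 1`. [folklore] -/
theorem lev_ge_of_mem_Efar {δ : MDir} {v t : Site 2} (ht : t ∈ C.Efar v δ) : 5 * (C.r : ℤ) + 1 ≤ C.lev δ v t := by
  rw [Efar, mem_psBox_iff] at ht; exact ht.1.1

/-- A point of the corridor `H_{v,δ}` NOT of level `> L` inside `E^far` has level `≤ L` (`5r ≤ L`). [folklore] -/
theorem lev_le_of_mem_Hfull_of_not_past {δ : MDir} {v t : Site 2} (ht : t ∈ C.Hfull v δ) {L : ℤ} (hL : 5 * (C.r : ℤ) ≤ L)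
    (hn : ¬(t ∈ C.Efar v δ ∧ L + 1 ≤ C.lev δ v t)) : C.lev δ v t ≤ L := by
  by_contra hlt
  push Not at hlt
  apply hn
  rw [Hfull, mem_psBox_iff] at ht
  refine ⟨?_, by omega⟩
  rw [Efar, mem_psBox_iff]
  unfold lev at hlt
  exact ⟨⟨by omega, by omega⟩, by omega, by omega⟩

/-- A corridor point of level `≤ 5r + 10sj` lies in the stub `H^j`. [folklore] -/
theorem mem_Stub_of_mem_Hfull {δ : MDir} {v t : Site 2} (ht : t ∈ C.Hfull v δ) {j : ℕ} (hl : C.lev δ v t ≤ 5 * C.r + 10 * C.s * j) :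
    t ∈ C.Stub v δ j := by
  rw [Hfull, mem_psBox_iff] at ht
  rw [Stub, mem_psBox_iff]
  unfold lev at hl
  exact ⟨⟨ht.1.1, hl⟩, ht.2⟩

/-- A corridor point of level exactly `5r + 10sj` lies on the face `F^j`. [folklore] -/
theorem mem_Face_of_mem_Hfull {δ : MDir} {v t : Site 2} (ht : t ∈ C.Hfull v δ) {j : ℕ} (hl : C.lev δ v t = 5 * C.r + 10 * C.s * j) :
    t ∈ C.Face v δ j := by
  rw [Hfull, mem_psBox_iff] at ht
  rw [Face, mem_psBox_iff]
  unfold lev at hl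
  exact ⟨⟨hl.ge, hl.le⟩, ht.2⟩

/-- Points of `M_{v+δ}` have level at least `17 r`. [folklore] -/
theorem lev_ge_of_mem_M_add {δ : MDir} {v t : Site 2} (ht : t ∈ C.M (v + stepVec δ)) : 17 * (C.r : ℤ) ≤ C.lev δ v t := by
  rw [M, C.mem_sq_iff] at ht
  have h := ht δ.1
  rw [C.cen_add_stepVec_fst] at h
  push_cast at h
  unfold lev; rcases sgOf_sign δ with hs | hs <;> rw [hs] at h ⊢ <;> omega

/-! ## The reversed between-box -/

/-- **The between-box of a directed macro-edge equals that of the reversed edge** (planar). [folklore] -/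
theorem Btw_rev' (v : Site 2) (δ : MDir) : (C.Btw (v + stepVec δ) (rev δ) : Finset (Site 2)) = C.Btw v δ := by
  ext t
  have hax : (rev δ).1 = δ.1 := rfl
  rw [Btw, Btw, mem_psBox_iff, mem_psBox_iff, hax, Cells.sgOf_rev, C.cen_add_stepVec_fst, C.cen_add_stepVec_oth]
  rcases sgOf_sign δ with hs | hs <;> rw [hs] <;> constructor <;> rintro ⟨⟨h1, h2⟩, h3, h4⟩ <;>
    exact ⟨⟨by omega, by omega⟩, h3, h4⟩

/-! ## No-edge separation -/

/-- Two planar points that differ in both coordinates are neither equal nor adjacent. [folklore] -/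
theorem sep_of_two_ne {y z : Site 2} (h0 : y 0 ≠ z 0) (h1 : y 1 ≠ z 1) : y ≠ z ∧ ¬(zdGraph 2).Adj y z := by
  refine ⟨fun h => h0 (by rw [h]), fun hadj => ?_⟩
  obtain ⟨i, σ, -, rfl⟩ := adj_iff_exists_sign.1 hadj
  fin_cases i
  · exact h1 (by simp)
  · exact h0 (by simp)

/-- Macro-coordinate comparison: the five cases with their centre relations. [folklore] -/
theorem cen_cases (u v : Site 2) (i : Fin 2) :
    (u i + 2 ≤ v i ∧ C.cen u i + 40 * (C.r : ℤ) ≤ C.cen v i) ∨ (u i + 1 = v i ∧ C.cen u i + 20 * (C.r : ℤ) = C.cen v i) ∨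
    (u i = v i ∧ C.cen u i = C.cen v i) ∨ (u i = v i + 1 ∧ C.cen u i = C.cen v i + 20 * (C.r : ℤ)) ∨
    (v i + 2 ≤ u i ∧ C.cen v i + 40 * (C.r : ℤ) ≤ C.cen u i) := by
  simp only [cen_apply]
  have hr : (0 : ℤ) ≤ C.r := by positivity
  rcases lt_trichotomy (u i) (v i) with h | h | h
  · rcases eq_or_lt_of_le (show u i + 1 ≤ v i by omega) with h' | h'
    · exact Or.inr (Or.inl ⟨h', by rw [← h']; ring⟩)
    · exact Or.inl ⟨by omega, by nlinarith⟩
  · exact Or.inr (Or.inr (Or.inl ⟨h, by rw [h]⟩))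
  · rcases eq_or_lt_of_le (show v i + 1 ≤ u i by omega) with h' | h'
    · exact Or.inr (Or.inr (Or.inr (Or.inl ⟨h'.symm, by rw [← h']; ring⟩)))
    · exact Or.inr (Or.inr (Or.inr (Or.inr ⟨by omega, by nlinarith⟩)))

/-- **Cells of other macro-vertices are separated from `E^far_{v,δ}`** (`u ≠ v`, `u ≠ v + δ`): no common vertex, no edge.
[cite: KozmaNitzan2024, §4 p. 31] -/
theorem Cell_sep_Efar {u v : Site 2} {δ : MDir} (huv : u ≠ v) (hux : u ≠ v + stepVec δ) :
    KozmaNitzan.Sep (↑(C.Cell u) : Set (Site 2)) ↑(C.Efar v δ) := by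
  intro y hy z hz
  rw [Finset.mem_coe, Cell, C.mem_sq_iff] at hy
  rw [Finset.mem_coe, Efar, mem_psBox_iff] at hz
  obtain ⟨⟨hz1, hz2⟩, hz3, hz4⟩ := hz
  have hya := hy δ.1; have hyb := hy (oth δ.1)
  push_cast at hya hyb
  have hr : (1 : ℤ) ≤ C.r := by exact_mod_cast C.one_le_r
  have hxa : (v + stepVec δ) δ.1 = v δ.1 + sgOf δ := by rw [Pi.add_apply, stepVec_apply_fst]
  have hxb : (v + stepVec δ) (oth δ.1) = v (oth δ.1) := by rw [Pi.add_apply, stepVec_apply_oth, add_zero]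
  -- `u` and `v` differ in some macro-coordinate
  rcases C.cen_cases u v (oth δ.1) with ⟨hk, hc⟩ | ⟨hk, hc⟩ | ⟨hk, hc⟩ | ⟨hk, hc⟩ | ⟨hk, hc⟩
  · exact sep_of_gap (oth δ.1) (by omega)
  · exact sep_of_gap (oth δ.1) (by omega)
  · -- same row: compare along the axis, `u_a ∉ {v_a, v_a + σ}`
    have hne1 : u δ.1 ≠ v δ.1 := fun h => huv (eq_of_coords δ.1 h hk)
    have hne2 : u δ.1 ≠ v δ.1 + sgOf δ := fun h => hux (eq_of_coords δ.1 (by rw [hxa, h]) (by rw [hxb, hk]))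
    rcases C.cen_cases u v δ.1 with ⟨hk', hc'⟩ | ⟨hk', hc'⟩ | ⟨hk', hc'⟩ | ⟨hk', hc'⟩ | ⟨hk', hc'⟩ <;>
      rcases sgOf_sign δ with hs | hs <;> rw [hs] at hz1 hz2 hne2 <;>
      first | exact absurd hk' hne1 | exact sep_of_gap δ.1 (by omega)
  · exact sep_of_gap (oth δ.1) (by omega)
  · exact sep_of_gap (oth δ.1) (by omega)

/-- **Other between-boxes of `v` are separated from `E^far_{v,δ}`** (`δ' ≠ δ`). [cite: KozmaNitzan2024, §4 p. 31] -/
theorem Btw_sep_Efar (v : Site 2) {δ δ' : MDir} (h : δ' ≠ δ) : KozmaNitzan.Sep (↑(C.Btw v δ') : Set (Site 2)) ↑(C.Efar v δ) := by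
  intro y hy z hz
  rw [Finset.mem_coe, Btw, mem_psBox_iff] at hy
  rw [Finset.mem_coe, Efar, mem_psBox_iff] at hz
  obtain ⟨⟨hy1, hy2⟩, hy3, hy4⟩ := hy
  obtain ⟨⟨hz1, hz2⟩, hz3, hz4⟩ := hz
  by_cases hax : δ'.1 = δ.1
  · -- same axis, opposite signs: levels on opposite sides, gap along the axis
    have hsg : sgOf δ' = -sgOf δ := by
      have hne : δ'.2 ≠ δ.2 := fun h2 => h (Prod.ext hax h2)
      unfold sgOf; rcases Bool.eq_false_or_eq_true δ.2 with hb | hb <;> simp_all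
    rw [hax, hsg] at hy1 hy2
    refine sep_of_gap δ.1 ?_
    rcases sgOf_sign δ with hs | hs <;> rw [hs] at hy1 hy2 hz1 hz2 <;> omega
  · -- different axes: the points differ in both coordinates
    have hoth : δ.1 = oth δ'.1 := eq_oth_of_ne (Ne.symm hax)
    have hoth' : δ'.1 = oth δ.1 := eq_oth_of_ne hax
    rw [← hoth] at hy3 hy4
    rw [← hoth'] at hz3 hz4
    have hne_a : y δ.1 ≠ z δ.1 := by
      intro heq; rcases sgOf_sign δ with hs | hs <;> rw [hs] at hz1 <;> omega
    have hne_a' : y δ'.1 ≠ z δ'.1 := by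
      intro heq; rcases sgOf_sign δ' with hs | hs <;> rw [hs] at hy1 <;> omega
    have h01 : ∀ i : Fin 2, y i ≠ z i := by
      intro i
      rcases eq_or_ne i δ.1 with rfl | hi
      · exact hne_a
      · rw [eq_oth_of_ne hi, ← hoth']; exact hne_a'
    exact sep_of_two_ne (h01 0) (h01 1)

/-- **Stub zones of other macro-vertices are separated from `E^far_{v,δ}`** (`u ≠ v`, `u ≠ v + δ`). [cite: KozmaNitzan2024, §4 p. 31] -/
theorem Zone_sep_Efar {u v : Site 2} {δ : MDir} (huv : u ≠ v) (hux : u ≠ v + stepVec δ) (δ' : MDir) :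
    KozmaNitzan.Sep (↑(C.Zone u δ') : Set (Site 2)) ↑(C.Efar v δ) := by
  intro y hy z hz
  rw [Finset.mem_coe, Zone, mem_psBox_iff] at hy
  rw [Finset.mem_coe, Efar, mem_psBox_iff] at hz
  obtain ⟨⟨hy1, hy2⟩, hy3, hy4⟩ := hy
  obtain ⟨⟨hz1, hz2⟩, hz3, hz4⟩ := hz
  have hr : (1 : ℤ) ≤ C.r := by exact_mod_cast C.one_le_r
  have hs1 : (1 : ℤ) ≤ C.s := by exact_mod_cast C.hs
  have hs20 : 20 * (C.s : ℤ) ≤ C.r := by exact_mod_cast C.twenty_mul_s_le_r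
  have hxa : (v + stepVec δ) δ.1 = v δ.1 + sgOf δ := by rw [Pi.add_apply, stepVec_apply_fst]
  have hxb : (v + stepVec δ) (oth δ.1) = v (oth δ.1) := by rw [Pi.add_apply, stepVec_apply_oth, add_zero]
  by_cases hax : δ'.1 = δ.1
  · -- zone axis = far axis
    rw [hax] at hy1 hy2 hy3 hy4
    rcases C.cen_cases u v (oth δ.1) with ⟨hk, hc⟩ | ⟨hk, hc⟩ | ⟨hk, hc⟩ | ⟨hk, hc⟩ | ⟨hk, hc⟩
    · exact sep_of_gap (oth δ.1) (by omega)
    · exact sep_of_gap (oth δ.1) (by omega)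
    · have hne1 : u δ.1 ≠ v δ.1 := fun h => huv (eq_of_coords δ.1 h hk)
      have hne2 : u δ.1 ≠ v δ.1 + sgOf δ := fun h => hux (eq_of_coords δ.1 (by rw [hxa, h]) (by rw [hxb, hk]))
      rcases C.cen_cases u v δ.1 with ⟨hk', hc'⟩ | ⟨hk', hc'⟩ | ⟨hk', hc'⟩ | ⟨hk', hc'⟩ | ⟨hk', hc'⟩ <;>
        rcases sgOf_sign δ with hs | hs <;> rw [hs] at hz1 hz2 hne2 <;>
        rcases sgOf_sign δ' with hs' | hs' <;> rw [hs'] at hy1 hy2 <;>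
        first | exact absurd hk' hne1 | exact sep_of_gap δ.1 (by omega)
    · exact sep_of_gap (oth δ.1) (by omega)
    · exact sep_of_gap (oth δ.1) (by omega)
  · -- zone axis `δ'.1 = oth δ.1`: the zone's transverse coordinate is the far axis
    have hoth : δ'.1 = oth δ.1 := eq_oth_of_ne hax
    have hoth2 : oth δ'.1 = δ.1 := by rw [hoth, oth_oth]
    rw [hoth2] at hy3 hy4
    rw [hoth] at hy1 hy2
    -- compare along the far axis `δ.1`: `y` is within `2r` of `cen u`, `z` is at level `≥ 5r+1` from `cen v`
    rcases C.cen_cases u v δ.1 with ⟨hk, hc⟩ | ⟨hk, hc⟩ | ⟨hk, hc⟩ | ⟨hk, hc⟩ | ⟨hk, hc⟩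
    · exact sep_of_gap δ.1 (by rcases sgOf_sign δ with hs | hs <;> rw [hs] at hz1 hz2 <;> omega)
    · rcases sgOf_sign δ with hs | hs <;> rw [hs] at hz1 hz2
      · exact sep_of_gap δ.1 (by omega)
      · -- `u_a = v_a - 1 = x_a` (σ = -1): compare the transverse coordinate
        rcases C.cen_cases u v (oth δ.1) with ⟨hm, hd⟩ | ⟨hm, hd⟩ | ⟨hm, hd⟩ | ⟨hm, hd⟩ | ⟨hm, hd⟩ <;>
          rcases sgOf_sign δ' with hs' | hs' <;> rw [hs'] at hy1 hy2 <;>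
          exact sep_of_gap (oth δ.1) (by omega)
    · exact sep_of_gap δ.1 (by rcases sgOf_sign δ with hs | hs <;> rw [hs] at hz1 hz2 <;> omega)
    · rcases sgOf_sign δ with hs | hs <;> rw [hs] at hz1 hz2
      · -- `u_a = v_a + 1 = x_a` (σ = 1): compare the transverse coordinate
        rcases C.cen_cases u v (oth δ.1) with ⟨hm, hd⟩ | ⟨hm, hd⟩ | ⟨hm, hd⟩ | ⟨hm, hd⟩ | ⟨hm, hd⟩ <;>
          rcases sgOf_sign δ' with hs' | hs' <;> rw [hs'] at hy1 hy2 <;>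
          exact sep_of_gap (oth δ.1) (by omega)
      · exact sep_of_gap δ.1 (by omega)
    · exact sep_of_gap δ.1 (by rcases sgOf_sign δ with hs | hs <;> rw [hs] at hz1 hz2 <;> omega)

end PCells

end Transplant

end Summit.CriticalPhenomena.PercolationContinuityZ3.Theorems

end
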